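import Mathlib
import Summits.NavierStokesRegularity.NavierStokesRegularity.Theorems.TypeIQuarterGateScarEnvelopeTypeIZoomDictionaryDefs
import Summits.NavierStokesRegularity.NavierStokesRegularity.Theorems.TypeIQuarterGateScarEnvelopeTypeIZoomDictionaryAbstract
import Summits.NavierStokesRegularity.NavierStokesRegularity.Theorems.TypeIQuarterGateScarEnvelopeTypeIZoomDictionaryLemmas
import Summits.NavierStokesRegularity.NavierStokesRegularity.Theorems.TypeIQuarterGateScarEnvelopeTypeIZoomDictionaryUnit
import Summits.NavierStokesRegularity.NavierStokesRegularity.Theorems.TypeIQuarterGateScarEnvelopeTypeIZoomDictionaryPersistence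

/-!
# Part D: the vertex row (`ν = 1`) — the Leray-continuation pressure

Part D of the plate: the vertex row — plain scaled bounds at the blow-up vertex from the Leray-continuation pressure, `budgetAt_iff_noSatellite_of_typeI`, `octaveBudget_iff_noSatellite_of_cruxHypotheses`.

PROVENANCE: declaration texts VERBATIM from the HOME plates of the instrument seat nsreg-p3 (g24/g25, cell
`pub/ns-regularity-ideate`): `round-31/Tangent31prep.lean` v5 (sha16 `e5b8668e3a090216`; = ROUND-30 plate v10 + Part K) and,
for Part L, `round-32/Tangent32prep.lean` v6 (sha16 `6123f27718636121`);
the author cannot write under `Theorems/` (`perm.theorems-prover-only`); landed by the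
LEAD-lineage prover ns-sz-p1 g5 on director-ns DIRECTOR-NS #218 (2), split into ≤ 400-line modules (the
plate's `def`s gathered in `TypeIQuarterGateScarEnvelopeTypeIZoomDictionaryDefs`), namespace
`Summit.NavierStokesRegularity.NavierStokesRegularity.Cruxes.ScarEnvelopeTypeI.ZoomDictionary` (the plate's `NsregP3.R30P`), `E3` spelled out, one-line docstrings
added where the plate had none.  `--supports stmt-NavierStokesRegularity-23843 --as helper`.

HONEST FRAMING: dictionary / census TOOLING for the crux `TypeIQuarterGate.ScarEnvelopeTypeI` (item 23843):
equivalences and normal forms, kernel-checked; NO open statement is proved — 23843, its parent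
`QuarterLawTypeI` (23726), the route and Navier–Stokes regularity are OPEN; hard core evaded: none.
-/

-- the summit-side namespace repeats a component by design (single-conjunct summit, D-0017)
set_option linter.dupNamespace false

open MeasureTheory Set Metric Filter Topology
open scoped ENNReal

namespace Summit.NavierStokesRegularity.NavierStokesRegularity.Cruxes.ScarEnvelopeTypeI.ZoomDictionary

variable {u : ℝ → (EuclideanSpace ℝ (Fin 3)) → (EuclideanSpace ℝ (Fin 3))} {a : (EuclideanSpace ℝ (Fin 3))} {ν T : ℝ}

section UnitNormalisation

open Literature.Analysis.FluidPDE
variable {u : ℝ → (EuclideanSpace ℝ (Fin 3)) → (EuclideanSpace ℝ (Fin 3))} {p : ℝ → (EuclideanSpace ℝ (Fin 3)) → ℝ} {a : (EuclideanSpace ℝ (Fin 3))} {T : ℝ}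

/-! ### The vertex row (ν = 1): the Leray-continuation pressure

Route of the tree's `stub_cknC_ceiling_of_isTypeIBlowup`, keeping `D`: Leray's global continuation
`(v, q)` of the datum `u 0` is suitable on the slab `(0, T+1) × ℝ³`, coincides with `u` a.e. on the strip
`(0,T) × ℝ³` (weak–strong uniqueness, strong class from Tao's localisation), obeys the Type-I rate a.e.
on a small vertex cylinder, so `scaledEnergies_bounded_of_typeIRate` bounds `A + E + C + D ≤ K` there;
`(u, q)` is then in A–B's class on the vertex cylinders (`congr_ae'`) with `C(r;u) = C(r;v) ≤ K`,
`D(r;q) ≤ K`. -/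

/-- **The vertex row.** For `(u,p)` classical on `[0,T)` (ν = 1), Leray–Hopf from the rapidly decaying
datum `u 0`, with the Type-I rate: there is a pressure `q` (that of Leray's global continuation) with
`ZoomsInBall u q a T` and `ZoomsBddU u q a T` at every `a`. -/
theorem exists_pressure_zooms_of_typeI (hT : 0 < T)
    (hcl : IsClassicalNSSolutionOn (Ico 0 T) 1 0 u p) (hLH : IsLerayHopfOn T 1 0 (u 0) u)
    (hdec : HasRapidSpatialDecay (u 0)) (hTI : IsTypeIBlowup u T) :
    ∃ q : ℝ → (EuclideanSpace ℝ (Fin 3)) → ℝ, ZoomsInBall u q a T ∧ ZoomsBddU u q a T := by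
  -- ### the Leray continuation: a global suitable Leray–Hopf solution from `u 0`
  have hu0 : MemLp (u 0) 2 volume := hLH.memLp 0 ⟨le_rfl, hT.le⟩
  have hdiv : IsWeaklyDivFree (u 0) := hLH.isWeaklyDivFree_datum hT
  obtain ⟨v, q, hGL, -, hvmeas, -, hq32, hv3, hLE⟩ :=
    exists_isGlobalLerayHopf_and_isLocalEnergySolutionOn (zero_lt_one : (0 : ℝ) < 1) hu0 hdiv
  -- ### weak–strong uniqueness on `[0, T']`, `T' < T`: `v(t) = u(t)` a.e. for `0 < t < T`
  have hslice : ∀ t ∈ Ioo 0 T, v t =ᵐ[volume] u t := by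
    intro t ht
    have hT' : (t + T) / 2 ∈ Ioo 0 T := ⟨by linarith [ht.1], by linarith [ht.2]⟩
    have hS : MemLqLp ⊤ ⊤ u (Ioo 0 ((t + T) / 2)) :=
      tao2011_hasBoundedSobolevNormsOn.memLqLp_top tao2011_hasBoundedSobolevNormsOn_holds
        linfty_bound_of_hasBoundedSobolevNormsOn_holds 1 T zero_lt_one hT u p hcl hLH hdec _ hT'
    have hu' : IsLerayHopfOn ((t + T) / 2) 1 0 (u 0) u := hLH.of_le hT'.2.le
    have hv' : IsLerayHopfOn ((t + T) / 2) 1 0 (u 0) v := hGL _ hT'.1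
    have h3 : (3 : ℝ≥0∞) < ⊤ := ENNReal.ofNat_lt_top
    have hqr : 2 / (⊤ : ℝ≥0∞) + 3 / (⊤ : ℝ≥0∞) ≤ 1 := by simp
    exact weak_strong_uniqueness_holds zero_lt_one hT'.1 hu' h3 hqr hS hv' t
      ⟨ht.1, by linarith [ht.2]⟩
  -- ### space–time a.e. equality on the strip `(0, T) × ℝ³`
  have hcont : ContinuousOn (Function.uncurry u) (Ioo 0 T ×ˢ (univ : Set (EuclideanSpace ℝ (Fin 3)))) :=
    continuousOn_of_classical hcl
  have humeas : AEStronglyMeasurable (Function.uncurry u)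
      (volume.restrict (Ioo 0 T ×ˢ (univ : Set (EuclideanSpace ℝ (Fin 3))))) :=
    hcont.aestronglyMeasurable (measurableSet_Ioo.prod MeasurableSet.univ)
  have hvmeas' : AEStronglyMeasurable (Function.uncurry v)
      (volume.restrict (Ioo 0 T ×ˢ (univ : Set (EuclideanSpace ℝ (Fin 3))))) := by
    have e : ((volume : Measure ℝ).restrict (Ioi 0)).prod (volume : Measure (EuclideanSpace ℝ (Fin 3))) =
        volume.restrict (Ioi (0 : ℝ) ×ˢ (univ : Set (EuclideanSpace ℝ (Fin 3)))) := by
      rw [Measure.volume_eq_prod, ← Measure.restrict_univ (μ := (volume : Measure (EuclideanSpace ℝ (Fin 3)))),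
        Measure.prod_restrict, Measure.restrict_univ]
    rw [e] at hvmeas
    exact hvmeas.mono_measure
      (Measure.restrict_mono (Set.prod_mono Ioo_subset_Ioi_self Subset.rfl) le_rfl)
  have hae : Function.uncurry v =ᵐ[volume.restrict (Ioo 0 T ×ˢ (univ : Set (EuclideanSpace ℝ (Fin 3))))]
      Function.uncurry u :=
    ae_restrict_prod_of_forall_ae_eq hslice hvmeas' humeas
  -- ### on the open slab `(0, T+1) × ℝ³ ∋ (T, a)` the pair `(v, q)` is suitable
  have hsw : IsSuitableWeakSolutionOn (slab (EuclideanSpace ℝ (Fin 3)) (Ioo 0 (T + 1)) isOpen_Ioo) 1 0 v q :=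
    (hLE (T + 1) (by linarith)).suitable
  obtain ⟨G, hGw, -, -⟩ := hsw.localEnergy
  have hcylT : ∀ {r : ℝ}, r ^ 2 < T →
      parabolicCylinder r ((T, a) : ℝ × (EuclideanSpace ℝ (Fin 3))) ⊆ Ioo 0 T ×ˢ (univ : Set (EuclideanSpace ℝ (Fin 3))) := by
    intro r hrT w hw
    rw [mem_parabolicCylinder] at hw
    have hw1 : T - r ^ 2 < w.1 := hw.1.1
    have hw2 : w.1 < T := hw.1.2
    exact ⟨⟨by linarith, hw2⟩, mem_univ _⟩
  -- ### the Type-I rate on a final time interval `(t₁, T)`, and a small radius `r₀`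
  obtain ⟨C, hC⟩ := hTI
  obtain ⟨t₁, ht₁T, ht₁⟩ :
      ∃ t₁ : ℝ, t₁ < T ∧ ∀ t ∈ Ioo t₁ T, ∀ x, ‖u t x‖ ≤ C / Real.sqrt (T - t) := by
    obtain ⟨l, hl, hsub⟩ := mem_nhdsLT_iff_exists_Ioo_subset.1 hC
    exact ⟨l, hl, fun t ht => hsub ht⟩
  set t₂ : ℝ := max t₁ 0 with ht₂
  have ht₂T : t₂ < T := max_lt ht₁T hT
  set d : ℝ := T - t₂ with hd
  have hd0 : 0 < d := by rw [hd]; linarith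
  set r₀ : ℝ := Real.sqrt d / 2 with hr₀
  have hr₀0 : 0 < r₀ := div_pos (Real.sqrt_pos.2 hd0) two_pos
  have hr₀sq : r₀ ^ 2 = d / 4 := by
    rw [hr₀, div_pow, Real.sq_sqrt hd0.le]; norm_num
  have hrd : ∀ {r : ℝ}, 0 < r → r ≤ r₀ → t₂ < T - r ^ 2 := by
    intro r hr hrr₀
    have h1 : r ^ 2 ≤ r₀ ^ 2 := pow_le_pow_left₀ hr.le hrr₀ 2
    rw [hr₀sq] at h1
    have h2 : d / 4 < d := by linarith
    rw [hd] at h1 h2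
    linarith
  have hrT : ∀ {r : ℝ}, 0 < r → r ≤ r₀ → r ^ 2 < T := by
    intro r hr hrr₀
    have := hrd hr hrr₀
    have h0 : (0 : ℝ) ≤ t₂ := le_max_right _ _
    linarith
  have hr₀T : r₀ ^ 2 < T := hrT hr₀0 le_rfl
  -- closed vertex boxes of radius `r ≤ r₀` lie in the slab
  have hbox : ∀ {r : ℝ}, 0 < r → r ≤ r₀ →
      Icc (((T, a) : ℝ × (EuclideanSpace ℝ (Fin 3))).1 - r ^ 2) ((T, a) : ℝ × (EuclideanSpace ℝ (Fin 3))).1 ×ˢ closedBall ((T, a) : ℝ × (EuclideanSpace ℝ (Fin 3))).2 r ⊆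
        ((slab (EuclideanSpace ℝ (Fin 3)) (Ioo 0 (T + 1)) isOpen_Ioo : TopologicalSpace.Opens (ℝ × (EuclideanSpace ℝ (Fin 3)))) : Set (ℝ × (EuclideanSpace ℝ (Fin 3)))) := by
    intro r hr hrr₀ w hw
    have hw1 : T - r ^ 2 ≤ w.1 := hw.1.1
    have hw2 : w.1 ≤ T := hw.1.2
    have := hrT hr hrr₀
    show w ∈ Ioo 0 (T + 1) ×ˢ (univ : Set (EuclideanSpace ℝ (Fin 3)))
    exact ⟨⟨by linarith, by linarith⟩, mem_univ _⟩
  have hcylQ : parabolicCylinder r₀ ((T, a) : ℝ × (EuclideanSpace ℝ (Fin 3))) ⊆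
      ((slab (EuclideanSpace ℝ (Fin 3)) (Ioo 0 (T + 1)) isOpen_Ioo : TopologicalSpace.Opens (ℝ × (EuclideanSpace ℝ (Fin 3)))) : Set (ℝ × (EuclideanSpace ℝ (Fin 3)))) :=
    (parabolicCylinder_subset_Icc_prod_closedBall _ r₀).trans (hbox hr₀0 le_rfl)
  -- ### `C(r₀; v) < ∞`, `D(r₀; q) < ∞`: `v ∈ L³`, `q ∈ L^{3/2}` of the strip
  have hCtop : cknC r₀ ((T, a) : ℝ × (EuclideanSpace ℝ (Fin 3))) v ≠ ∞ := by
    unfold cknC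
    refine ENNReal.mul_ne_top ?_
      (lt_of_le_of_lt (lintegral_mono_set (hcylT hr₀T)) (hv3 T hT)).ne
    exact ENNReal.inv_ne_top.2 (pow_ne_zero _ (ENNReal.ofReal_pos.2 hr₀0).ne')
  have hDtop : cknD r₀ ((T, a) : ℝ × (EuclideanSpace ℝ (Fin 3))) q ≠ ∞ := by
    unfold cknD
    refine ENNReal.mul_ne_top ?_
      (lt_of_le_of_lt (lintegral_mono_set (hcylT hr₀T)) (hq32 T hT)).ne
    exact ENNReal.inv_ne_top.2 (pow_ne_zero _ (ENNReal.ofReal_pos.2 hr₀0).ne')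
  -- ### the rate `√(T - t) ‖v‖ ≤ C` a.e. on `Q_{r₀}(T, a)` (there `v = u` a.e. and `t₁ < t < T`)
  have hrate : ∀ᵐ w ∂(volume.restrict (parabolicCylinder r₀ ((T, a) : ℝ × (EuclideanSpace ℝ (Fin 3))))),
      Real.sqrt (((T, a) : ℝ × (EuclideanSpace ℝ (Fin 3))).1 - w.1) * ‖v w.1 w.2‖ ≤ C := by
    have hae' : ∀ᵐ w ∂(volume.restrict (parabolicCylinder r₀ ((T, a) : ℝ × (EuclideanSpace ℝ (Fin 3))))),
        Function.uncurry v w = Function.uncurry u w :=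
      ae_restrict_of_ae_restrict_of_subset (hcylT hr₀T) hae
    filter_upwards [hae', ae_restrict_mem (isOpen_parabolicCylinder r₀ _).measurableSet]
      with w hw hwQ
    have hw' : v w.1 w.2 = u w.1 w.2 := hw
    rw [mem_parabolicCylinder] at hwQ
    have hw1 : T - r₀ ^ 2 < w.1 := hwQ.1.1
    have hw2 : w.1 < T := hwQ.1.2
    have hwt₁ : t₁ < w.1 := lt_of_le_of_lt (le_max_left _ _) ((hrd hr₀0 le_rfl).trans hw1)
    have hsq : 0 < Real.sqrt (T - w.1) := Real.sqrt_pos.2 (by linarith)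
    have hb := ht₁ w.1 ⟨hwt₁, hw2⟩ w.2
    show Real.sqrt (T - w.1) * ‖v w.1 w.2‖ ≤ C
    rw [hw']
    calc Real.sqrt (T - w.1) * ‖u w.1 w.2‖
        ≤ Real.sqrt (T - w.1) * (C / Real.sqrt (T - w.1)) := mul_le_mul_of_nonneg_left hb hsq.le
      _ = C := by field_simp
  -- ### Seregin: bounded scaled energies of `(v, q)` at the vertex `(T, a)`
  obtain ⟨K, hK⟩ := scaledEnergies_bounded_of_typeIRate hsw hGw hr₀0 hcylQ hCtop hDtop ⟨C, hrate⟩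
  -- ### `(u, q)` is in A–B's class on every vertex cylinder of radius `≤ r₀`
  have hIB : ∀ r, 0 < r → r ≤ r₀ → IsSuitableWeakSolutionInBall r ((T, a) : ℝ × (EuclideanSpace ℝ (Fin 3))) u q := by
    intro r hr hrr₀
    have hae' : ∀ᵐ w ∂(volume.restrict (parabolicCylinder r ((T, a) : ℝ × (EuclideanSpace ℝ (Fin 3))))),
        Function.uncurry v w = Function.uncurry u w :=
      ae_restrict_of_ae_restrict_of_subset (hcylT (hrT hr hrr₀)) hae
    exact (hsw.isSuitableWeakSolutionInBall (hbox hr hrr₀)).congr_ae' hae'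
      (Filter.Eventually.of_forall fun _ => rfl)
  refine ⟨q, ⟨r₀, hr₀0, fun L hL hLr => ?_⟩, ?_⟩
  · have h := (hIB L hL hLr).zoom hL
    rw [zoom_eq_smul_stPull, zoomP_eq_smul_stPull]
    exact h
  · have hr₁ : 0 < r₀ / 4 := by positivity
    refine zoomsBddU_of_vertexBounds (M := (K : ℝ≥0∞)) (D := (K : ℝ≥0∞)) ENNReal.coe_lt_top
      ENNReal.coe_lt_top hr₁ (fun r hr hrle => ?_) (fun r hr hrle => ?_)
    · have hr' : r ∈ Ioo 0 (r₀ / 2) := ⟨hr, by linarith⟩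
      have hrr₀ : r ≤ r₀ := by linarith
      have hae' : ∀ᵐ w ∂(volume.restrict (parabolicCylinder r ((T, a) : ℝ × (EuclideanSpace ℝ (Fin 3))))),
          Function.uncurry v w = Function.uncurry u w :=
        ae_restrict_of_ae_restrict_of_subset (hcylT (hrT hr hrr₀)) hae
      rw [← cknC_congr_ae hae']
      exact (le_add_right (le_add_left le_rfl)).trans (hK r hr')
    · have hr' : r ∈ Ioo 0 (r₀ / 2) := ⟨hr, by linarith⟩
      exact le_add_self.trans (hK r hr')

/-- **ROUND-30 (α) in the kernel, ν = 1.** For `(u,p)` classical on `[0,T)`, Leray–Hopf from the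
rapidly decaying datum `u 0`, with the Type-I rate: the slice budget at `a` holds iff for EVERY
pressure `q` with `ZoomsInBall u q a T ∧ ZoomsBddU u q a T` (such a `q` exists:
`exists_pressure_zooms_of_typeI`) no tangent flow of `(u, q)` at `(a,T)` has a final-time satellite on
the closed unit annulus.  No print theorem is a hypothesis. -/
theorem budgetAt_iff_noSatellite_of_typeI (hT : 0 < T)
    (hcl : IsClassicalNSSolutionOn (Ico 0 T) 1 0 u p) (hLH : IsLerayHopfOn T 1 0 (u 0) u)
    (hdec : HasRapidSpatialDecay (u 0)) (hTI : IsTypeIBlowup u T) :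
    BudgetAt 1 T u a ↔ ∀ q : ℝ → (EuclideanSpace ℝ (Fin 3)) → ℝ, ZoomsInBall u q a T → ZoomsBddU u q a T →
      ∀ L ū, TangentU u q a T L ū → ∀ y ∈ unitAnn, RegU ū y := by
  have hcont := continuousOn_of_classical hcl
  constructor
  · intro hB q hZ hBd
    exact (dictionaryU' hT hcont hTI hZ hBd).1 hB
  · intro h
    obtain ⟨q, hZ, hBd⟩ := exists_pressure_zooms_of_typeI (a := a) hT hcl hLH hdec hTI
    exact (dictionaryU' hT hcont hTI hZ hBd).2 (h q hZ hBd)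

/-- **The same over the SD stub's hypothesis `CruxHypotheses 1 T u p` (tree
`…Cruxes.ScarEnvelopeTypeI.ScarZoom.CruxHypotheses`), for the tree's `OctaveBudget 1 T u`.** -/
theorem octaveBudget_iff_noSatellite_of_cruxHypotheses
    (h : Summit.NavierStokesRegularity.NavierStokesRegularity.Cruxes.ScarEnvelopeTypeI.ScarZoom.CruxHypotheses
      1 T u p) :
    Summit.NavierStokesRegularity.NavierStokesRegularity.Cruxes.ScarEnvelopeTypeI.SliceBudget.OctaveBudget
        1 T u ↔
      ∀ a, Summit.NavierStokesRegularity.NavierStokesRegularity.Cruxes.ScarEnvelopeTypeI.SliceBudget.SingularPt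
          T u a → ∀ q : ℝ → (EuclideanSpace ℝ (Fin 3)) → ℝ, ZoomsInBall u q a T → ZoomsBddU u q a T →
            ∀ L ū, TangentU u q a T L ū → ∀ y ∈ unitAnn, RegU ū y := by
  obtain ⟨-, hT, hmax, hLH, hdec, hTI, -⟩ := h
  rw [octaveBudget_iff_budgetAt]
  refine forall_congr' fun a => imp_congr_right fun _ => ?_
  exact budgetAt_iff_noSatellite_of_typeI hT hmax.isClassicalNSSolutionOn hLH hdec hTI

end UnitNormalisation

end Summit.NavierStokesRegularity.NavierStokesRegularity.Cruxes.ScarEnvelopeTypeI.ZoomDictionary
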